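import Summits.QuantumAdvantage.QuantumAdvantage.Theses.ArithStatLadder
import Literature.NumberTheory.QuadraticFields.ThreeTorsion

/-!
# `DigitRung` (stmt-QuantumAdvantage-2423) — reduction and load-bearing analysis (negative-side support)

Route `ArithStatLadder`, crux rank 2. Landed from the refuter's standing `Cruxes/DigitRung/Disproof.lean`
(cdisprove, 2026-08-16). Nothing here asserts the crux; everything is sorry-free.

* `digitRung_iff`, `digitRung_iff_canonical` — the crux quantifies over every statistic `t` pinned to
  `#Cl(K)[3]`; it is EQUIVALENT to its instance at the tree's total function `quadFieldThreeTorsion`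
  (all sums run over fundamental `−d`, where every pinned `t` agrees with it): one statement to prove
  or refute; the `∀ t` is neither a weakening nor vacuous (`pins_canonical`).
* `digitRung_false_without_pins` — the pinning hypothesis is load-bearing: dropped, `t := 0` breaks the
  conclusion at the top digit (blocks are non-empty from `n = 6`, `d = 8p` by Bertrand).
* `digitRung_implies_dyadicMeanTwo` — the top digit alone is the Davenport–Heilbronn law "mean of
  `#Cl₃(−d)` over `n`-bit fundamental `−d` → 2" (in the tree only as the named fact
  `bst_threeTorsion_mean`): the centring constant `2` is forced.
* `not_digitRung_iff` — the shape a disproof must take.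
-/

noncomputable section

namespace Summit.QuantumAdvantage.DigitRung.Negative

open scoped Classical
open Filter Finset
open Literature.NumberTheory.QuadraticFields
open Summit.QuantumAdvantage.QuantumAdvantage.Theses.ArithStatLadder (DigitRung)

/-! ## Vocabulary (literal abbreviations of the crux body) -/

/-- `−d` is a fundamental discriminant — the literal predicate of the route file (an `abbrev`, so
that instance search builds the same `Decidable` term as in the route and `digitRung_iff` is `rfl`). -/
abbrev IsNegFund (d : ℕ) : Prop :=
  ((-(d:ℤ)) % 4 = 1 ∧ Squarefree (-(d:ℤ)) ∧ (-(d:ℤ)) ≠ 1) ∨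
    (4 ∣ (-(d:ℤ)) ∧ ((-(d:ℤ)) / 4 % 4 = 2 ∨ (-(d:ℤ)) / 4 % 4 = 3) ∧ Squarefree ((-(d:ℤ)) / 4))

/-- `𝒟_n`: the `n`-bit `d` (i.e. `2^{n-1} ≤ d < 2^n`) with `−d` fundamental. -/
def block (n : ℕ) : Finset ℕ :=
  (Finset.Ico (2 ^ (n - 1)) (2 ^ n)).filter fun d : ℕ => IsNegFund d

/-- The digit half `{d ∈ 𝒟_n : bit_j(d) = b}`. -/
def half (n j : ℕ) (b : Bool) : Finset ℕ :=
  (block n).filter fun d : ℕ => Nat.testBit d j = b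

/-- The centred digit sum `Σ_{d ∈ 𝒟_n, bit_j d = b} (t(−d) − 2)`. -/
def dev (t : ℤ → ℕ) (n j : ℕ) (b : Bool) : ℝ :=
  ∑ d ∈ half n j b, ((t (-(d:ℤ)) : ℝ) - 2)

/-- The pinning hypothesis of the route: `t D = #Cl(K)[3]` for every quadratic field `K` of
discriminant `D`. -/
def Pins (t : ℤ → ℕ) : Prop :=
  ∀ (D : ℤ) (K : Type) [Field K] [NumberField K], Module.finrank ℚ K = 2 →
    NumberField.discr K = D →
      t D = Nat.card {c : ClassGroup (NumberField.RingOfIntegers K) // c ^ 3 = 1}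

/-- The conclusion of the rung for a given statistic `t`. -/
def Concl (t : ℤ → ℕ) : Prop :=
  ∀ ε : ℝ, 0 < ε → ∀ᶠ n : ℕ in atTop, ∀ j < n, ∀ b : Bool,
    |dev t n j b| ≤ ε * ((block n).card : ℝ)

/-- The crux, literally, is `∀ t, Pins t → Concl t`. [folklore] -/
theorem digitRung_iff : DigitRung ↔ ∀ t : ℤ → ℕ, Pins t → Concl t := Iff.rfl

/-! ## Reduction to the canonical statistic `quadFieldThreeTorsion` -/

/-- The tree's total function `quadFieldThreeTorsion` is pinned (ThreeTorsion.lean). [folklore] -/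
theorem pins_canonical : Pins quadFieldThreeTorsion :=
  fun D K _ _ h2 hD => quadFieldThreeTorsion_eq D K h2 hD

/-- A pinned statistic agrees with `quadFieldThreeTorsion` at every fundamental `−d`
(a quadratic field of that discriminant exists: `Quadratic.exists_numberField_discr_eq`). [folklore] -/
theorem Pins.apply_eq {t : ℤ → ℕ} (ht : Pins t) {d : ℕ} (hd : IsNegFund d) :
    t (-(d:ℤ)) = quadFieldThreeTorsion (-(d:ℤ)) := by
  obtain ⟨K, _, _, h2, hdisc⟩ := Quadratic.exists_numberField_discr_eq hd
  rw [ht _ K h2 hdisc, quadFieldThreeTorsion_eq _ K h2 hdisc]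

/-- Membership in `block n`, unfolded. [folklore] -/
theorem mem_block {n d : ℕ} : d ∈ block n ↔ (2 ^ (n - 1) ≤ d ∧ d < 2 ^ n) ∧ IsNegFund d := by
  simp [block]

/-- Membership in `half n j b`, unfolded. [folklore] -/
theorem mem_half {n j d : ℕ} {b : Bool} :
    d ∈ half n j b ↔ d ∈ block n ∧ Nat.testBit d j = b := by
  simp [half]

/-- On every digit half, a pinned statistic has the same centred sum as the canonical one. [folklore] -/
theorem Pins.dev_eq {t : ℤ → ℕ} (ht : Pins t) (n j : ℕ) (b : Bool) :
    dev t n j b = dev quadFieldThreeTorsion n j b := by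
  unfold dev
  refine Finset.sum_congr rfl fun d hd => ?_
  rw [ht.apply_eq (mem_block.mp (mem_half.mp hd).1).2]

/-- **Reduction.** `DigitRung` is equivalent to its single instance at `quadFieldThreeTorsion`:
the `∀ t` of the crux is bookkeeping, neither a weakening nor a source of vacuity. [folklore] -/
theorem digitRung_iff_canonical : DigitRung ↔ Concl quadFieldThreeTorsion := by
  rw [digitRung_iff]
  refine ⟨fun h => h _ pins_canonical, fun h t ht ε hε => ?_⟩
  filter_upwards [h ε hε] with n hn j hj b
  rw [ht.dev_eq]
  exact hn j hj b

/-! ## Load-bearing hypothesis: without pinning the rung is false -/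

/-- The crux with the pinning hypothesis dropped. -/
def DigitRungWithoutPins : Prop := ∀ t : ℤ → ℕ, Concl t

/-- `−8p` is a fundamental discriminant for every odd prime `p`. [folklore] -/
theorem isNegFund_eight_mul {p : ℕ} (hp : p.Prime) (hp2 : p ≠ 2) : IsNegFund (8 * p) := by
  right
  have hodd : Odd p := hp.odd_of_ne_two hp2
  have hdiv : (-((8 * p : ℕ) : ℤ)) / 4 = -(2 * p) := by
    rw [show (-((8 * p : ℕ) : ℤ)) = 4 * (-(2 * p)) by push_cast; ring]
    exact Int.mul_ediv_cancel_left _ (by norm_num)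
  refine ⟨⟨-(2 * p), by push_cast; ring⟩, ?_, ?_⟩
  · left
    rw [hdiv]
    obtain ⟨k, hk⟩ := hodd
    subst hk
    push_cast
    omega
  · rw [hdiv, ← Int.squarefree_natAbs,
      show (-(2 * (p : ℤ))).natAbs = 2 * p by simp [Int.natAbs_mul]]
    exact (Nat.squarefree_mul (Nat.coprime_two_left.mpr hodd)).mpr
      ⟨Nat.prime_two.prime.squarefree, hp.prime.squarefree⟩

/-- Blocks are non-empty from `n = 6` on: Bertrand gives a prime `2^{n-4} < p ≤ 2^{n-3}`
(necessarily `< 2^{n-3}` and odd), and `d = 8p` is an `n`-bit number with `−d` fundamental. [folklore] -/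
theorem block_nonempty {n : ℕ} (hn : 6 ≤ n) : (block n).Nonempty := by
  obtain ⟨p, hp, hlt, hle⟩ := Nat.exists_prime_lt_and_le_two_mul (2 ^ (n - 4)) (by positivity)
  have hp2 : p ≠ 2 := by
    rintro rfl
    have : 2 ^ 2 ≤ 2 ^ (n - 4) := Nat.pow_le_pow_right two_pos (by omega)
    omega
  have hple : p < 2 ^ (n - 3) := by
    rcases hle.lt_or_eq with h | h
    · calc p < 2 * 2 ^ (n - 4) := h
        _ = 2 ^ (n - 3) := by rw [← pow_succ']; congr 1; omega
    · exfalso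
      have h2 : p = 2 ^ (n - 4 + 1) := by rw [h, pow_succ']
      exact hp2 ((Nat.Prime.eq_one_or_self_of_dvd hp 2
        ⟨2 ^ (n - 4), by rw [h2, pow_succ']⟩).resolve_left (by norm_num)).symm
  refine ⟨8 * p, mem_block.mpr ⟨⟨?_, ?_⟩, isNegFund_eight_mul hp hp2⟩⟩
  · calc 2 ^ (n - 1) = 8 * 2 ^ (n - 4) := by
          rw [show (8 : ℕ) = 2 ^ 3 by norm_num, ← pow_add]; congr 1; omega
      _ ≤ 8 * p := by omega
  · calc 8 * p < 8 * 2 ^ (n - 3) := by omega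
      _ = 2 ^ n := by rw [show (8 : ℕ) = 2 ^ 3 by norm_num, ← pow_add]; congr 1; omega

/-- Every `d` in the block has its top bit `n − 1` set. [folklore] -/
theorem testBit_pred_of_mem_block {n d : ℕ} (hn : 1 ≤ n) (hd : d ∈ block n) :
    Nat.testBit d (n - 1) = true := by
  obtain ⟨⟨hlo, hhi⟩, -⟩ := mem_block.mp hd
  by_contra hbit
  rw [Bool.not_eq_true] at hbit
  have : d < 2 ^ (n - 1) := by
    apply Nat.lt_pow_two_of_testBit
    intro i hi
    rcases Nat.lt_or_ge i n with hin | hin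
    · have : i = n - 1 := by omega
      subst this
      exact hbit
    · exact Nat.testBit_lt_two_pow (hhi.trans_le (Nat.pow_le_pow_right two_pos hin))
  omega

/-- The top-digit half `b = true` is the whole block. [folklore] -/
theorem half_pred_true {n : ℕ} (hn : 1 ≤ n) : half n (n - 1) true = block n := by
  ext d
  rw [mem_half]
  exact ⟨fun h => h.1, fun h => ⟨h, testBit_pred_of_mem_block hn h⟩⟩

/-- **`Pins` is load-bearing.** With the hypothesis dropped, `t := 0` violates the conclusion at
the top digit: `|Σ_{𝒟_n} (0 − 2)| = 2·#𝒟_n > 1·#𝒟_n` as soon as `𝒟_n ≠ ∅` (`n ≥ 6`). [folklore] -/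
theorem digitRung_false_without_pins : ¬ DigitRungWithoutPins := by
  intro h
  have hev := h (fun _ => 0) 1 one_pos
  rw [Filter.eventually_atTop] at hev
  obtain ⟨N, hN⟩ := hev
  set n := max N 6 with hn
  have hn6 : 6 ≤ n := le_max_right _ _
  have key := hN n (le_max_left _ _) (n - 1) (by omega) true
  unfold dev at key
  rw [half_pred_true (by omega)] at key
  simp only [Nat.cast_zero, zero_sub, Finset.sum_const, nsmul_eq_mul, mul_neg, one_mul,
    abs_neg] at key
  have hpos : (0 : ℝ) < (block n).card := by exact_mod_cast (block_nonempty hn6).card_pos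
  rw [abs_of_pos (by positivity)] at key
  linarith

/-! ## The top digit forces the Davenport–Heilbronn dyadic mean -/

/-- **DigitRung ⇒ dyadic Davenport–Heilbronn.** The case `j = n − 1`, `b = true` of the crux is
exactly "the mean of `#Cl₃(−d)` over `n`-bit fundamental `−d` tends to `2`", i.e. the imaginary
half of BST Cor. 7 / Davenport–Heilbronn Thm 3 differenced over dyadic blocks. So the crux is at
least as strong as (dyadic) DH, which the tree holds only as the named fact
`bst_threeTorsion_mean`; and the centring constant `2` cannot be replaced by any other real
number (a version centred at `c ≠ 2` contradicts DH). [folklore] -/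
theorem digitRung_implies_dyadicMeanTwo (h : DigitRung) :
    ∀ ε : ℝ, 0 < ε → ∀ᶠ n : ℕ in atTop,
      |∑ d ∈ block n, ((quadFieldThreeTorsion (-(d:ℤ)) : ℝ) - 2)| ≤ ε * ((block n).card : ℝ) := by
  intro ε hε
  have hc := (digitRung_iff_canonical.mp h) ε hε
  filter_upwards [hc, Filter.eventually_ge_atTop 1] with n hn hn1
  have := hn (n - 1) (by omega) true
  rwa [dev, half_pred_true hn1] at this

/-- Contrapositive, the shape a disproof would take: exhibit `ε > 0` and infinitely many `n` with a
digit half whose centred `#Cl₃`-sum exceeds `ε·#𝒟_n`. By `digitRung_iff_canonical` only the canonical statistic matters.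
[folklore] -/
theorem not_digitRung_iff :
    ¬ DigitRung ↔ ∃ ε : ℝ, 0 < ε ∧ ∃ᶠ n : ℕ in atTop, ∃ j < n, ∃ b : Bool,
      ε * ((block n).card : ℝ) < |dev quadFieldThreeTorsion n j b| := by
  simp only [digitRung_iff_canonical, Concl, not_forall, Filter.not_eventually, not_le, exists_prop]

end Summit.QuantumAdvantage.DigitRung.Negative

end
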